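import Summits.ResolutionOfSingularities.ResolutionOfSingularities.Theorems.FrobeniusClosingPatchingRelPerfectConeTiltCharts
import Summits.ResolutionOfSingularities.ResolutionOfSingularities.Theorems.FrobeniusClosingPatchingRelPerfectConeMemberChartIdeals
import HarnessLib

/-!
# Crux `PatchingRelPerfect` (stmt-ResolutionOfSingularities-16161), chain w52 — the rank-two member
# `f = x₀x₁ + x₂³`: chart ideals of the PLANE blow-up `Bl_{(u, e₀)}` (level two, design stage)

[OURS · L1 W5.2 · rung, DESIGN STAGE] Sequel of `…TwoPlanesCharts` (this seat's design note
NEXT-two-planes-cube.md; images machine-checked over `ℚ`, kit j282646).  Abstract setting: `A` a ring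
(it will be a chart `B₂` or `B₃` of `Bl_𝔪`), `u, e₀ ∈ A` (the centre `Π₀ = V(u, e₀)`), and the strict
transform `H = e₀ y + u z` of `f` (`y = e₁`, `z = e₂³` on `B₃`, `z = 1` on `B₂`).  On the two Rees
charts of `Bl_{(u, e₀)} Spec A` (family `(u, e₀)`; exceptional parameter `w`):

* `e₀`-chart («`t`-chart», `u = w t`, `e₀ ↦ w`, `H ↦ w c`, `c = y + t z`):
  `(e₀y, u) ↦ (w)(c, t)`, `(H, u e₀, u²) ↦ (w)(c, w t)`, `(H, u²) ↦ (w)(c, w t²)` — the letter flag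
  `(c, t)(c, t w)(c, t w t)` (`map_tpA3_t`, `map_tpA4_t`, `map_tpK_t`);
* `u`-chart («`s`-chart», `u ↦ w`, `e₀ = w s`, `H ↦ w h″`, `h″ = s y + z`): `(e₀y, u) ↦ (w)`,
  `(H, u e₀, u²) ↦ (w)(h″, w)`, `(H, u²) ↦ (w)(h″, w)` (`map_tpA3_s`, `map_tpA4_s`, `map_tpK_s`).

Generic identities over ring maps, then the chart instances.  Nothing here is a statement of the
manuscript under review.

## References

* The Stacks Project, Tags 0804, 080B. [StacksProject]
-/

-- `Summit.<Summit>.<Sub>.Theorems` with `Sub = Summit` (single-conjunct summit, D-0017)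
set_option linter.dupNamespace false

noncomputable section

open CategoryTheory CategoryTheory.Limits AlgebraicGeometry Literature.AlgebraicGeometry.Resolution
open IsLocalRing

namespace Summit.ResolutionOfSingularities.ResolutionOfSingularities.Theorems

namespace TwoPlanesRung

universe u

/-! ## Generic identities -/

section Generic

variable {R B : Type*} [CommRing R] [CommRing B] (ψ : R →+* B) (uu e₀ y z : R)
  (w t y' z' : B)

/-- `t`-chart: `(e₀ y, u) ↦ (w) · (y' + t z', t)`. [folklore] -/
theorem map_tpA3_t_aux (hu : ψ uu = w * t) (he : ψ e₀ = w * 1) (hy : ψ y = y') :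
    (Ideal.span {e₀ * y, uu}).map ψ = Ideal.span {w} * Ideal.span {y' + t * z', t} := by
  rw [Ideal.map_span, Set.image_insert_eq, Set.image_singleton, map_mul, hu, he, hy, mul_one,
    ConeRung.span_singleton_mul_span_pair]
  have e1 : w * (y' + t * z') = w * y' + w * t * z' := by ring
  rw [e1, @Ideal.span_pair_comm _ _ (w * y') (w * t),
    @Ideal.span_pair_comm _ _ (w * y' + w * t * z') (w * t), ConeRung.span_pair_add_mul]

/-- `t`-chart: `(H, u e₀, u²) ↦ (w) · (c, w t)`, `H = e₀ y + u z ↦ w c`, `c = y' + t z'`. [folklore] -/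
theorem map_tpA4_t_aux (hu : ψ uu = w * t) (he : ψ e₀ = w * 1) (hy : ψ y = y') (hz : ψ z = z') :
    (Ideal.span {e₀ * y + uu * z} ⊔ Ideal.span {uu} * Ideal.span {e₀} ⊔ Ideal.span {uu} ^ 2).map ψ =
      Ideal.span {w} * Ideal.span {y' + t * z', w * t} := by
  rw [Ideal.map_sup, Ideal.map_sup, Ideal.map_mul, Ideal.map_pow, Ideal.map_span, Set.image_singleton,
    Ideal.map_span, Set.image_singleton, Ideal.map_span, Set.image_singleton, map_add, map_mul,
    map_mul, hu, he, hy, hz, mul_one, Ideal.span_singleton_mul_span_singleton, Ideal.span_singleton_pow]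
  have e1 : w * y' + w * t * z' = w * (y' + t * z') := by ring
  have e2 : w * t * w = w * (w * t) := by ring
  have e3 : (w * t) ^ 2 = w * (w * t) * t := by ring
  rw [e1, e2, e3, ConeRung.span_singleton_mul_span_pair, Ideal.span_insert]
  -- the last generator `w (w t) t` is a multiple of `w (w t)`
  exact sup_eq_left.mpr ((Ideal.span_singleton_le_iff_mem _).mpr
    (Ideal.mem_sup_right (Ideal.mem_span_singleton'.mpr ⟨t, by ring⟩)))

/-- `t`-chart: `(H, u²) ↦ (w) · (c, w t²)`. [folklore] -/
theorem map_tpK_t_aux (hu : ψ uu = w * t) (he : ψ e₀ = w * 1) (hy : ψ y = y') (hz : ψ z = z') :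
    (Ideal.span {e₀ * y + uu * z} ⊔ Ideal.span {uu} ^ 2).map ψ =
      Ideal.span {w} * Ideal.span {y' + t * z', w * t ^ 2} := by
  rw [Ideal.map_sup, Ideal.map_pow, Ideal.map_span, Set.image_singleton, Ideal.map_span,
    Set.image_singleton, map_add, map_mul, map_mul, hu, he, hy, hz, mul_one, Ideal.span_singleton_pow,
    ← Ideal.span_union, Set.singleton_union, ConeRung.span_singleton_mul_span_pair]
  have e1 : w * y' + w * t * z' = w * (y' + t * z') := by ring
  have e3 : (w * t) ^ 2 = w * (w * t ^ 2) := by ring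
  rw [e1, e3]

/-- `s`-chart: `(e₀ y, u) ↦ (w)` (`e₀ ↦ w s`, `u ↦ w`). [folklore] -/
theorem map_tpA3_s_aux (s : B) (hu : ψ uu = w * 1) (he : ψ e₀ = w * s) (hy : ψ y = y') :
    (Ideal.span {e₀ * y, uu}).map ψ = Ideal.span {w} := by
  rw [Ideal.map_span, Set.image_insert_eq, Set.image_singleton, map_mul, hu, he, hy, mul_one]
  apply le_antisymm
  · rw [Ideal.span_le]
    rintro b (rfl | rfl)
    · rw [mul_assoc]
      exact Ideal.mul_mem_right _ _ (Ideal.mem_span_singleton_self _)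
    · exact Ideal.mem_span_singleton_self _
  · exact Ideal.span_mono (Set.subset_insert _ _ |>.trans (Set.insert_subset_insert
      (Set.singleton_subset_iff.mpr rfl)))

/-- `s`-chart: `(H, u e₀, u²) ↦ (w) · (h″, w)`, `H ↦ w h″`, `h″ = s y' + z'`. [folklore] -/
theorem map_tpA4_s_aux (s : B) (hu : ψ uu = w * 1) (he : ψ e₀ = w * s) (hy : ψ y = y')
    (hz : ψ z = z') :
    (Ideal.span {e₀ * y + uu * z} ⊔ Ideal.span {uu} * Ideal.span {e₀} ⊔ Ideal.span {uu} ^ 2).map ψ =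
      Ideal.span {w} * Ideal.span {s * y' + z', w} := by
  rw [Ideal.map_sup, Ideal.map_sup, Ideal.map_mul, Ideal.map_pow, Ideal.map_span, Set.image_singleton,
    Ideal.map_span, Set.image_singleton, Ideal.map_span, Set.image_singleton, map_add, map_mul,
    map_mul, hu, he, hy, hz, mul_one, Ideal.span_singleton_mul_span_singleton, Ideal.span_singleton_pow]
  have e1 : w * s * y' + w * z' = w * (s * y' + z') := by ring
  have e2 : w * (w * s) = w * w * s := by ring
  rw [e1, e2, sq, ConeRung.span_singleton_mul_span_pair, Ideal.span_insert, sup_assoc]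
  -- the middle generator `w w s` is a multiple of `w w`
  congr 1
  exact sup_eq_right.mpr ((Ideal.span_singleton_le_iff_mem _).mpr (Ideal.mem_span_singleton'.mpr ⟨s, by ring⟩))

/-- `s`-chart: `(H, u²) ↦ (w) · (h″, w)`. [folklore] -/
theorem map_tpK_s_aux (s : B) (hu : ψ uu = w * 1) (he : ψ e₀ = w * s) (hy : ψ y = y')
    (hz : ψ z = z') :
    (Ideal.span {e₀ * y + uu * z} ⊔ Ideal.span {uu} ^ 2).map ψ =
      Ideal.span {w} * Ideal.span {s * y' + z', w} := by
  rw [Ideal.map_sup, Ideal.map_pow, Ideal.map_span, Set.image_singleton, Ideal.map_span,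
    Set.image_singleton, map_add, map_mul, map_mul, hu, he, hy, hz, mul_one, Ideal.span_singleton_pow,
    ← Ideal.span_union, Set.singleton_union, ConeRung.span_singleton_mul_span_pair, sq]
  have e1 : w * s * y' + w * z' = w * (s * y' + z') := by ring
  rw [e1]

end Generic

/-! ## The charts of `Bl_{(u, e₀)}` -/

section Charts

variable {A : Type u} [CommRing A] (uu e₀ y z : A)

local notation3 "cc" => (Fin.cons uu (fun _ : Fin 1 => e₀) : Fin 2 → A)
/-- the `e₀`-chart (`t`-chart): exceptional parameter `w₁ = ψ e₀`, `t = u/e₀` -/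
local notation3 "ψ₁" => chartBase cc 1
local notation3 "w₁" => chartBase cc 1 (cc 1)
local notation3 "tt" => chartGen cc 1 0
/-- the `u`-chart (`s`-chart): exceptional parameter `w₀ = ψ u`, `s = e₀/u` -/
local notation3 "ψ₀" => chartBase cc 0
local notation3 "w₀" => chartBase cc 0 (cc 0)
local notation3 "ss" => chartGen cc 0 1

/-- `ψ₁ u = w₁ t`. [cite: StacksProject, Tag 0804] -/
theorem chartBase_one_u : ψ₁ uu = w₁ * tt := reesChartBase_apply_eq_mul_chartGen cc 1 0

/-- `ψ₁ e₀ = w₁ · 1`. [cite: StacksProject, Tag 0804] -/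
theorem chartBase_one_e : ψ₁ e₀ = w₁ * 1 := by
  rw [← chartGen_self cc 1]
  exact reesChartBase_apply_eq_mul_chartGen cc 1 1

/-- `ψ₀ u = w₀ · 1`. [cite: StacksProject, Tag 0804] -/
theorem chartBase_zero_u : ψ₀ uu = w₀ * 1 := by
  rw [← chartGen_self cc 0]
  exact reesChartBase_apply_eq_mul_chartGen cc 0 0

/-- `ψ₀ e₀ = w₀ s`. [cite: StacksProject, Tag 0804] -/
theorem chartBase_zero_e : ψ₀ e₀ = w₀ * ss := reesChartBase_apply_eq_mul_chartGen cc 0 1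

/-- **`t`-chart: `(e₀ y, u) ↦ (w₁) · (c, t)`**, `c = ψ₁ y + t ψ₁ z`. [cite: StacksProject, Tag 080B] -/
theorem map_tpA3_t :
    (Ideal.span {e₀ * y, uu}).map ψ₁ = Ideal.span {w₁} * Ideal.span {ψ₁ y + tt * ψ₁ z, tt} :=
  map_tpA3_t_aux ψ₁ uu e₀ y w₁ tt (ψ₁ y) (ψ₁ z) (chartBase_one_u uu e₀) (chartBase_one_e uu e₀) rfl

/-- **`t`-chart: `(H, u e₀, u²) ↦ (w₁) · (c, w₁ t)`**. [cite: StacksProject, Tag 080B] -/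
theorem map_tpA4_t :
    (Ideal.span {e₀ * y + uu * z} ⊔ Ideal.span {uu} * Ideal.span {e₀} ⊔ Ideal.span {uu} ^ 2).map ψ₁ =
      Ideal.span {w₁} * Ideal.span {ψ₁ y + tt * ψ₁ z, w₁ * tt} :=
  map_tpA4_t_aux ψ₁ uu e₀ y z w₁ tt (ψ₁ y) (ψ₁ z) (chartBase_one_u uu e₀) (chartBase_one_e uu e₀)
    rfl rfl

/-- **`t`-chart: `(H, u²) ↦ (w₁) · (c, w₁ t²)`**. [cite: StacksProject, Tag 080B] -/
theorem map_tpK_t :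
    (Ideal.span {e₀ * y + uu * z} ⊔ Ideal.span {uu} ^ 2).map ψ₁ =
      Ideal.span {w₁} * Ideal.span {ψ₁ y + tt * ψ₁ z, w₁ * tt ^ 2} :=
  map_tpK_t_aux ψ₁ uu e₀ y z w₁ tt (ψ₁ y) (ψ₁ z) (chartBase_one_u uu e₀) (chartBase_one_e uu e₀)
    rfl rfl

/-- **`s`-chart: `(e₀ y, u) ↦ (w₀)`**. [cite: StacksProject, Tag 080B] -/
theorem map_tpA3_s : (Ideal.span {e₀ * y, uu}).map ψ₀ = Ideal.span {w₀} :=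
  map_tpA3_s_aux ψ₀ uu e₀ y w₀ (ψ₀ y) ss (chartBase_zero_u uu e₀) (chartBase_zero_e uu e₀) rfl

/-- **`s`-chart: `(H, u e₀, u²) ↦ (w₀) · (h″, w₀)`**, `h″ = s ψ₀ y + ψ₀ z`. [cite: StacksProject, Tag 080B] -/
theorem map_tpA4_s :
    (Ideal.span {e₀ * y + uu * z} ⊔ Ideal.span {uu} * Ideal.span {e₀} ⊔ Ideal.span {uu} ^ 2).map ψ₀ =
      Ideal.span {w₀} * Ideal.span {ss * ψ₀ y + ψ₀ z, w₀} :=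
  map_tpA4_s_aux ψ₀ uu e₀ y z w₀ (ψ₀ y) (ψ₀ z) ss (chartBase_zero_u uu e₀) (chartBase_zero_e uu e₀)
    rfl rfl

/-- **`s`-chart: `(H, u²) ↦ (w₀) · (h″, w₀)`**. [cite: StacksProject, Tag 080B] -/
theorem map_tpK_s :
    (Ideal.span {e₀ * y + uu * z} ⊔ Ideal.span {uu} ^ 2).map ψ₀ =
      Ideal.span {w₀} * Ideal.span {ss * ψ₀ y + ψ₀ z, w₀} :=
  map_tpK_s_aux ψ₀ uu e₀ y z w₀ (ψ₀ y) (ψ₀ z) ss (chartBase_zero_u uu e₀) (chartBase_zero_e uu e₀)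
    rfl rfl

end Charts

end TwoPlanesRung

end Summit.ResolutionOfSingularities.ResolutionOfSingularities.Theorems

end
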